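import Literature.MathematicalPhysics.QuantumLattice.HubbardFreePropagator
import Literature.MathematicalPhysics.QuantumLattice.HubbardFermiLiquid
import Literature.MathematicalPhysics.QuantumLattice.FermionQuasiFreeDynamics
import Literature.Probability.LatticeModels.BrillouinRiemannSum
import HarnessLib

/-!
# The free Hubbard propagator on the torus: functional calculus of `h_L`, unequal times, and
the thermodynamic limit (BGM (1.4) ⟶ (2.4) at `U = 0`)

Topic `MathematicalPhysics/QuantumLattice`; fourth piece of the free (`U = 0`) layer under the
named fact `bgm_two_point_limit` of `HubbardFermiLiquid.lean` (Benfatto–Giuliani–Mastropietro,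
Ann. Henri Poincaré 7 (2006) 809, Thm. 1.1: convergence of the finite-volume two-point functions
as `L → ∞` in their regime `0 < |U| ≤ U₀`). Building on `HubbardFreePropagator.lean` (plane waves
diagonalise `h_L = hubbardOneBody (fermionTorusGraph d L) 1 μ`; `freeFermiMatrix`),
`FermionQuasiFreeDynamics.lean` (unequal-time quasi-free two-point functions
`[e^{-sh}(1 + e^{±βh})⁻¹e^{th}]_{ji}`) and `BrillouinRiemannSum.lean` (Riemann sums of continuous
functions over the momentum grid converge), everything below is PROVED:

* `torusMultiplier c` — the Fourier multiplier `(T_c)_{(x,σ),(x',σ')} = δ_{σσ'} L^{-d} Σ_k χ_k(x-x') c(k)`;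
  `torusMultiplier_mulVec_planeWave` (`T_c (χ_k ⊗ e_τ) = c(k) χ_k ⊗ e_τ`),
  `ext_of_mulVec_planeWave` (a matrix is determined by its action on plane waves — they span),
  `torusMultiplier_mul` (`T_c T_{c'} = T_{cc'}`), `freeFermiMatrix_eq_torusMultiplier`,
  `exp_smul_hubbardOneBody_eq_torusMultiplier` (`e^{t h_L} = T_{e^{t(ε_L-μ)}}`, `L ≥ 3`): the
  functional calculus of `h_L`;
* `thermalCorr_torus_evolve_creation_annihilation`, `thermalCorr_torus_evolve_annihilation_creation`
  — BGM's free propagator at unequal imaginary times in finite volume (`L ≥ 3`):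
  `⟨a⁺_{(x,σ)}(t) a⁻_{(y,σ')}(s)⟩ = δ_{σσ'} L^{-d} Σ_k χ_k(y-x) e^{-(s-t)(ε_L(k)-μ)} f_β(ε_L(k)-μ)` and
  the other ordering with `1 - f_β`;
* `hubbardThermalTwoPointEvolved β U μ L x σ t y σ' s` — the finite-volume imaginary-time
  two-point function of the Hubbard torus (building block of BGM's (1.2); at `t = s = 0` the
  fact's `hubbardThermalTwoPoint`, `hubbardThermalTwoPointEvolved_zero_zero`);
  `hubbardThermalTwoPointEvolved_zero_interaction_eq_sum` — at `U = 0`, `3 ≤ L`, it is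
  `δ_{σσ'} L⁻² Σ_k F^{s-t}_{β,μ,y-x}(2πk/L)` with the continuous integrand
  `freePropagatorIntegrandTime β μ τ z p = e^{ip·z} e^{-τ(ε(p)-μ)} f_β(ε(p)-μ)`;
* `tendsto_hubbardThermalTwoPointEvolved_zero_interaction` — **the thermodynamic limit**
  `→ δ_{σσ'} (2π)⁻² ∫_{[-π,π]²} F^{s-t}_{β,μ,y-x}(q + π) dq` as `L → ∞` through all naturals
  (BGM's `S₀` (1.4) "in the limit `L → ∞`", eq. (2.4)), and its equal-time case
  `tendsto_hubbardThermalTwoPoint_zero_interaction` /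
  `exists_tendsto_hubbardThermalTwoPoint_zero_interaction` — the `U = 0` analogue of the
  conclusion of `bgm_two_point_limit`.

## References

* G. Benfatto, A. Giuliani, V. Mastropietro, Ann. Henri Poincaré 7 (2006) 809–898, §1.2,
  eqs. (1.2)–(1.4), and §2.1, eqs. (2.4)–(2.5). [BenfattoGiulianiMastropietro2006]
* S. Friedli, Y. Velenik, *Statistical Mechanics of Lattice Systems* (CUP 2017), §10.4.
  [FriedliVelenik2017]
-/

noncomputable section

namespace Literature.MathematicalPhysics.QuantumLattice

open NormedSpace Matrix Finset Filter Literature.Probability.LatticeModels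
open scoped Topology ComplexConjugate

/-! ### Fourier multipliers on the fermionic torus: the functional calculus of `h_L` -/

section Multiplier

variable {d L : ℕ} [NeZero L]

/-- The Fourier multiplier with symbol `c : (ℤ/Lℤ)^d → ℂ` on the orbitals of the fermionic
torus: `(T_c)_{(x,σ),(x',σ')} = δ_{σσ'} L^{-d} Σ_k χ_k(x - x') c(k)` (diagonal in spin, acting on
plane waves by `T_c (χ_k ⊗ e_τ) = c(k) (χ_k ⊗ e_τ)`; `freeFermiMatrix` is `T_{f_β(ε-μ)}`).
Friedli–Velenik 2017, §10.4 (Fourier analysis on the torus). [folklore] -/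
def torusMultiplier (c : TorusSite d L → ℂ) :
    Matrix (Orb (FermionTorus d L)) (Orb (FermionTorus d L)) ℂ :=
  Matrix.of fun o o' =>
    if (ofLex o).2 = (ofLex o').2 then
      ((L : ℂ) ^ d)⁻¹ * ∑ k : TorusSite d L,
        torusChar k ((ofLex o).1.toTorusSite - (ofLex o').1.toTorusSite) * c k
    else 0

/-- Entries of a Fourier multiplier. [folklore] -/
theorem torusMultiplier_orb (c : TorusSite d L → ℂ) (x x' : FermionTorus d L) (σ σ' : Fin 2) :
    torusMultiplier c (orb x σ) (orb x' σ') =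
      if σ = σ' then
        ((L : ℂ) ^ d)⁻¹ * ∑ k : TorusSite d L, torusChar k (x.toTorusSite - x'.toTorusSite) * c k
      else 0 := rfl

/-- `freeFermiMatrix` is the multiplier with symbol `f_β(ε_L(k) - μ)`. [folklore] -/
theorem freeFermiMatrix_eq_torusMultiplier (β μ : ℝ) :
    freeFermiMatrix (d := d) β μ L =
      torusMultiplier fun k => (fermiFunction β (torusBand L k - μ) : ℂ) := rfl

/-- **Orthogonality of characters, mixed form**: `Σ_x conj χ_{k'}(x) χ_k(x) = L^d δ_{kk'}`.
[folklore] -/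
theorem sum_conj_torusChar_mul_torusChar (k k' : TorusSite d L) :
    ∑ x : TorusSite d L, conj (torusChar k' x) * torusChar k x =
      if k = k' then (L : ℂ) ^ d else 0 := by
  have h := sum_torusChar_right (k - k')
  simp only [torusChar_sub_left, sub_eq_zero] at h
  simpa only [mul_comm] using h

/-- **Multipliers act diagonally on plane waves**: `T_c (χ_k ⊗ e_τ) = c(k) (χ_k ⊗ e_τ)`.
[folklore] -/
theorem torusMultiplier_mulVec_planeWave (c : TorusSite d L → ℂ) (k : TorusSite d L) (τ : Fin 2) :
    torusMultiplier c *ᵥ planeWave k τ = c k • planeWave k τ := by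
  funext o
  obtain ⟨⟨x, σ⟩, rfl⟩ : ∃ p : FermionTorus d L × Fin 2, toLex p = o := ⟨ofLex o, toLex_ofLex o⟩
  have hre : ∀ f : Orb (FermionTorus d L) → ℂ,
      ∑ o, f o = ∑ y : FermionTorus d L, ∑ σ' : Fin 2, f (orb y σ') := fun f => by
    rw [← Fintype.sum_prod_type', ← (toLex : FermionTorus d L × Fin 2 ≃ _).sum_comp]
  have hterm : ∀ (y : FermionTorus d L) (σ' : Fin 2),
      torusMultiplier c (orb x σ) (orb y σ') * planeWave k τ (orb y σ') =
        if σ = σ' then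
          (if σ = τ then
            ((L : ℂ) ^ d)⁻¹ * ∑ k' : TorusSite d L,
              torusChar k' (x.toTorusSite - y.toTorusSite) * c k' * torusChar k y.toTorusSite
          else 0)
        else 0 := by
    intro y σ'
    rw [torusMultiplier_orb, planeWave_orb]
    by_cases h1 : σ = σ'
    · subst h1
      by_cases h2 : σ = τ
      · simp only [h2, if_true, Finset.sum_mul, Finset.mul_sum]
        exact Finset.sum_congr rfl fun _ _ => by ring
      · simp [h2]
    · simp [h1]
  change (torusMultiplier c *ᵥ planeWave k τ) (orb x σ) = c k * planeWave k τ (orb x σ)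
  simp only [Matrix.mulVec, dotProduct]
  rw [hre]
  simp only [hterm, Finset.sum_ite_eq, Finset.mem_univ, if_true]
  rw [planeWave_orb]
  by_cases hσ : σ = τ
  · simp only [hσ, if_true]
    rw [FermionTorus.sum_eq_sum_torusSite]
    simp only [FermionTorus.toTorusSite_ofTorusSite, torusChar_sub_right, Finset.mul_sum]
    rw [Finset.sum_comm]
    have hk' : ∀ k' : TorusSite d L, ∑ z : TorusSite d L,
        ((L : ℂ) ^ d)⁻¹ * (torusChar k' x.toTorusSite * conj (torusChar k' z) * c k' *
          torusChar k z) =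
        ((L : ℂ) ^ d)⁻¹ * c k' * torusChar k' x.toTorusSite *
          ∑ z : TorusSite d L, conj (torusChar k' z) * torusChar k z := by
      intro k'
      rw [Finset.mul_sum]
      exact Finset.sum_congr rfl fun z _ => by ring
    simp only [hk', sum_conj_torusChar_mul_torusChar, mul_ite, mul_zero, Finset.sum_ite_eq,
      Finset.mem_univ, if_true]
    have hL0 : ((L : ℂ) ^ d) ≠ 0 := natCast_pow_ne_zero
    field_simp
  · have : ¬(τ = σ) := fun h => hσ h.symm
    simp [hσ]

/-- **A matrix on the fermionic torus is determined by its action on the plane waves** (the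
plane waves span: every basis vector is `e_{(x,σ)} = L^{-d} Σ_k conj χ_k(x) (χ_k ⊗ e_σ)`).
[folklore] -/
theorem ext_of_mulVec_planeWave {M M' : Matrix (Orb (FermionTorus d L)) (Orb (FermionTorus d L)) ℂ}
    (h : ∀ (k : TorusSite d L) (τ : Fin 2), M *ᵥ planeWave k τ = M' *ᵥ planeWave k τ) :
    M = M' := by
  -- expansion of the basis vectors in plane waves
  have hexp : ∀ (x' : FermionTorus d L) (σ' : Fin 2),
      (Pi.single (orb x' σ') (1 : ℂ) : Orb (FermionTorus d L) → ℂ) =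
        ∑ k : TorusSite d L, (((L : ℂ) ^ d)⁻¹ * conj (torusChar k x'.toTorusSite)) •
          planeWave k σ' := by
    intro x' σ'
    funext o
    obtain ⟨⟨x, σ⟩, rfl⟩ : ∃ p : FermionTorus d L × Fin 2, toLex p = o := ⟨ofLex o, toLex_ofLex o⟩
    change (Pi.single (orb x' σ') (1 : ℂ) : Orb (FermionTorus d L) → ℂ) (orb x σ) = _
    rw [Finset.sum_apply]
    simp only [Pi.smul_apply, planeWave_orb, smul_eq_mul, mul_ite, mul_zero, Pi.single_apply,
      orb_eq_orb_iff]
    by_cases hσ : σ = σ'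
    · simp only [hσ, and_true, if_true]
      have horth := sum_torusChar_left (x.toTorusSite - x'.toTorusSite)
      simp only [torusChar_sub_right] at horth
      have hinj : x.toTorusSite = x'.toTorusSite ↔ x = x' :=
        (FermionTorus.equivTorusSite (d := d) (L := L)).injective.eq_iff
      calc (if x = x' then (1 : ℂ) else 0)
          = ((L : ℂ) ^ d)⁻¹ *
              ∑ k, torusChar k x.toTorusSite * conj (torusChar k x'.toTorusSite) := by
            rw [horth]
            simp only [sub_eq_zero, hinj, mul_ite, mul_zero, inv_mul_cancel₀ natCast_pow_ne_zero]
        _ = _ := by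
            rw [Finset.mul_sum]
            exact Finset.sum_congr rfl fun k _ => by ring
    · simp [hσ]
  ext o o'
  obtain ⟨⟨x', σ'⟩, rfl⟩ : ∃ p : FermionTorus d L × Fin 2, toLex p = o' :=
    ⟨ofLex o', toLex_ofLex o'⟩
  have hcol : ∀ N : Matrix (Orb (FermionTorus d L)) (Orb (FermionTorus d L)) ℂ,
      N o (orb x' σ') = (N *ᵥ Pi.single (orb x' σ') 1) o := fun N => by
    rw [Matrix.mulVec_single_one]; rfl
  rw [hcol M, hcol M', hexp]
  simp only [Matrix.mulVec_sum, Matrix.mulVec_smul, h]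

/-- Multipliers compose by multiplying symbols: `T_c T_{c'} = T_{c c'}`. [folklore] -/
theorem torusMultiplier_mul (c c' : TorusSite d L → ℂ) :
    torusMultiplier c * torusMultiplier c' = torusMultiplier (fun k => c k * c' k) := by
  refine ext_of_mulVec_planeWave fun k τ => ?_
  rw [← Matrix.mulVec_mulVec, torusMultiplier_mulVec_planeWave, Matrix.mulVec_smul,
    torusMultiplier_mulVec_planeWave, torusMultiplier_mulVec_planeWave, smul_smul, mul_comm]

/-- **The imaginary-time evolution is a multiplier**: `e^{t h_L} = T_{e^{t(ε_L - μ)}}` for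
`h_L = hubbardOneBody (fermionTorusGraph d L) 1 μ`, `L ≥ 3`. [folklore] -/
theorem exp_smul_hubbardOneBody_eq_torusMultiplier (hL : 3 ≤ L) (μ : ℝ) (t : ℂ) :
    exp (t • hubbardOneBody (fermionTorusGraph d L) 1 μ) =
      torusMultiplier fun k => Complex.exp (t * ((torusBand L k - μ : ℝ) : ℂ)) := by
  refine ext_of_mulVec_planeWave fun k τ => ?_
  have hv : (t • hubbardOneBody (fermionTorusGraph d L) 1 μ) *ᵥ planeWave k τ =
      (t * ((torusBand L k - μ : ℝ) : ℂ)) • planeWave k τ := by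
    rw [Matrix.smul_mulVec, hubbardOneBody_mulVec_planeWave hL, smul_smul]
  rw [exp_mulVec_of_mulVec_eq_smul _ hv, torusMultiplier_mulVec_planeWave]

end Multiplier

/-! ### The free propagator on the torus at unequal imaginary times -/

section TimeDependent

variable {d L : ℕ} [NeZero L]

/-- **BGM's free propagator at unequal times, finite volume** (`L ≥ 3`), creation first:
`⟨a⁺_{(x,σ)}(t) a⁻_{(y,σ')}(s)⟩_{β,L,U=0} = δ_{σσ'} L^{-d} Σ_k χ_k(y - x) e^{-(s-t)(ε_L(k)-μ)} f_β(ε_L(k)-μ)`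
(minus the `x₀ ≤ y₀` branch of (1.4), in the tree's hopping-`1` convention).
BGM 2006, eqs. (1.2)–(1.4). [cite: BenfattoGiulianiMastropietro2006, eq. (1.4)] -/
theorem thermalCorr_torus_evolve_creation_annihilation (hL : 3 ≤ L) (β μ : ℝ) (s t : ℂ)
    (x y : FermionTorus d L) (σ σ' : Fin 2) :
    thermalCorr β (hamiltonianWith (fermionTorusGraph d L) 1 0 μ)
        (exp (t • hamiltonianWith (fermionTorusGraph d L) 1 0 μ) * creation (orb x σ) *
          exp (-(t • hamiltonianWith (fermionTorusGraph d L) 1 0 μ)))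
        (exp (s • hamiltonianWith (fermionTorusGraph d L) 1 0 μ) * annihilation (orb y σ') *
          exp (-(s • hamiltonianWith (fermionTorusGraph d L) 1 0 μ))) =
      if σ' = σ then
        ((L : ℂ) ^ d)⁻¹ * ∑ k : TorusSite d L, torusChar k (y.toTorusSite - x.toTorusSite) *
          (Complex.exp (-(s - t) * ((torusBand L k - μ : ℝ) : ℂ)) *
            (fermiFunction β (torusBand L k - μ) : ℂ))
      else 0 := by
  have hh := isHermitian_hubbardOneBody (fermionTorusGraph d L) 1 μ
  -- the general quasi-free formula, transported to this file's instance terms (`convert`)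
  have key : thermalCorr β (dGamma (hubbardOneBody (fermionTorusGraph d L) 1 μ))
      (exp (t • dGamma (hubbardOneBody (fermionTorusGraph d L) 1 μ)) * creation (orb x σ) *
        exp (-(t • dGamma (hubbardOneBody (fermionTorusGraph d L) 1 μ))))
      (exp (s • dGamma (hubbardOneBody (fermionTorusGraph d L) 1 μ)) * annihilation (orb y σ') *
        exp (-(s • dGamma (hubbardOneBody (fermionTorusGraph d L) 1 μ)))) =
      (exp (-(s • hubbardOneBody (fermionTorusGraph d L) 1 μ)) *
        (1 + exp ((β : ℂ) • hubbardOneBody (fermionTorusGraph d L) 1 μ))⁻¹ *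
        exp (t • hubbardOneBody (fermionTorusGraph d L) 1 μ)) (orb y σ') (orb x σ) := by
    convert thermalCorr_dGamma_evolve_creation_annihilation hh β s t (orb x σ) (orb y σ') using 8
  rw [hamiltonianWith_zero_eq_dGamma, key,
    fermiMatrix_torus_eq_freeFermiMatrix hL, freeFermiMatrix_eq_torusMultiplier,
    show -(s • hubbardOneBody (fermionTorusGraph d L) 1 μ) =
      (-s) • hubbardOneBody (fermionTorusGraph d L) 1 μ from (neg_smul _ _).symm,
    exp_smul_hubbardOneBody_eq_torusMultiplier hL, exp_smul_hubbardOneBody_eq_torusMultiplier hL,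
    torusMultiplier_mul, torusMultiplier_mul, torusMultiplier_orb]
  refine if_congr Iff.rfl ?_ rfl
  congr 1
  refine Finset.sum_congr rfl fun k _ => ?_
  congr 1
  rw [mul_right_comm, ← Complex.exp_add]
  congr 1
  ring

/-- **BGM's free propagator at unequal times, finite volume** (`L ≥ 3`), annihilation first:
`⟨a⁻_{(y,σ')}(s) a⁺_{(x,σ)}(t)⟩_{β,L,U=0} = δ_{σσ'} L^{-d} Σ_k χ_k(y - x) e^{-(s-t)(ε_L(k)-μ)} (1 - f_β(ε_L(k)-μ))`
(the `x₀ > y₀` branch of (1.4): `(1 + e^{-β(ε-μ)})⁻¹ = 1 - f_β(ε-μ)`).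
BGM 2006, eqs. (1.2)–(1.4). [cite: BenfattoGiulianiMastropietro2006, eq. (1.4)] -/
theorem thermalCorr_torus_evolve_annihilation_creation (hL : 3 ≤ L) (β μ : ℝ) (s t : ℂ)
    (x y : FermionTorus d L) (σ σ' : Fin 2) :
    thermalCorr β (hamiltonianWith (fermionTorusGraph d L) 1 0 μ)
        (exp (s • hamiltonianWith (fermionTorusGraph d L) 1 0 μ) * annihilation (orb y σ') *
          exp (-(s • hamiltonianWith (fermionTorusGraph d L) 1 0 μ)))
        (exp (t • hamiltonianWith (fermionTorusGraph d L) 1 0 μ) * creation (orb x σ) *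
          exp (-(t • hamiltonianWith (fermionTorusGraph d L) 1 0 μ))) =
      if σ' = σ then
        ((L : ℂ) ^ d)⁻¹ * ∑ k : TorusSite d L, torusChar k (y.toTorusSite - x.toTorusSite) *
          (Complex.exp (-(s - t) * ((torusBand L k - μ : ℝ) : ℂ)) *
            (1 - (fermiFunction β (torusBand L k - μ) : ℂ)))
      else 0 := by
  have hh := isHermitian_hubbardOneBody (fermionTorusGraph d L) 1 μ
  have key : thermalCorr β (dGamma (hubbardOneBody (fermionTorusGraph d L) 1 μ))
      (exp (s • dGamma (hubbardOneBody (fermionTorusGraph d L) 1 μ)) * annihilation (orb y σ') *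
        exp (-(s • dGamma (hubbardOneBody (fermionTorusGraph d L) 1 μ))))
      (exp (t • dGamma (hubbardOneBody (fermionTorusGraph d L) 1 μ)) * creation (orb x σ) *
        exp (-(t • dGamma (hubbardOneBody (fermionTorusGraph d L) 1 μ)))) =
      (exp (-(s • hubbardOneBody (fermionTorusGraph d L) 1 μ)) *
        (1 + exp (-((β : ℂ) • hubbardOneBody (fermionTorusGraph d L) 1 μ)))⁻¹ *
        exp (t • hubbardOneBody (fermionTorusGraph d L) 1 μ)) (orb y σ') (orb x σ) := by
    convert thermalCorr_dGamma_evolve_annihilation_creation hh β s t (orb x σ) (orb y σ') using 8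
  have hsub' : (1 + exp (-((β : ℂ) • hubbardOneBody (fermionTorusGraph d L) 1 μ)))⁻¹ =
      1 - (1 + exp ((β : ℂ) • hubbardOneBody (fermionTorusGraph d L) 1 μ))⁻¹ := by
    convert (one_sub_fermiMatrix hh β).symm using 12
  rw [hamiltonianWith_zero_eq_dGamma, key, hsub', fermiMatrix_torus_eq_freeFermiMatrix hL,
    freeFermiMatrix_eq_torusMultiplier,
    show -(s • hubbardOneBody (fermionTorusGraph d L) 1 μ) =
      (-s) • hubbardOneBody (fermionTorusGraph d L) 1 μ from (neg_smul _ _).symm,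
    exp_smul_hubbardOneBody_eq_torusMultiplier hL, exp_smul_hubbardOneBody_eq_torusMultiplier hL]
  -- `1 = T_1`
  have h1 : (1 : Matrix (Orb (FermionTorus d L)) (Orb (FermionTorus d L)) ℂ) =
      torusMultiplier fun _ => 1 :=
    ext_of_mulVec_planeWave fun k τ => by
      rw [Matrix.one_mulVec, torusMultiplier_mulVec_planeWave, one_smul]
  have hsub : torusMultiplier (fun _ => (1 : ℂ)) -
      torusMultiplier (fun k => (fermiFunction β (torusBand L k - μ) : ℂ)) =
      torusMultiplier (d := d) (L := L) fun k => 1 - (fermiFunction β (torusBand L k - μ) : ℂ) :=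
    ext_of_mulVec_planeWave fun k τ => by
      rw [Matrix.sub_mulVec, torusMultiplier_mulVec_planeWave, torusMultiplier_mulVec_planeWave,
        torusMultiplier_mulVec_planeWave, sub_smul]
  rw [h1, hsub, torusMultiplier_mul, torusMultiplier_mul, torusMultiplier_orb]
  refine if_congr Iff.rfl ?_ rfl
  congr 1
  refine Finset.sum_congr rfl fun k _ => ?_
  congr 1
  rw [mul_right_comm, ← Complex.exp_add]
  congr 1
  ring

end TimeDependent

/-! ### The imaginary-time two-point function of the Hubbard torus and its free limit -/

section Evolved

/-- The finite-volume imaginary-time two-point function of the 2D Hubbard torus,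
`⟨a⁺_{(x,σ)}(t) a⁻_{(y,σ')}(s)⟩_{β,L} = tr(e^{-βH} e^{tH} c†_{xσ} e^{-tH} e^{sH} c_{yσ'} e^{-sH}) / Z`,
`H = H_L(t=1, U) - μN`, for lattice sites `x, y ∈ ℤ²` projected to the torus and complex times
`t, s` (junk `0` for `L = 0`); at `t = s = 0` this is the fact's `hubbardThermalTwoPoint`. These
are the building blocks of BGM's Schwinger functions (1.2) (before time ordering).
[cite: BenfattoGiulianiMastropietro2006, eq. (1.2)] -/
def hubbardThermalTwoPointEvolved (β U μ : ℝ) (L : ℕ) (x : Site 2) (σ : Fin 2) (t : ℂ)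
    (y : Site 2) (σ' : Fin 2) (s : ℂ) : ℂ :=
  if hL : L = 0 then 0
  else
    haveI : NeZero L := ⟨hL⟩
    thermalCorr β (hubbardTorusWith 2 L 1 U μ)
      (exp (t • hubbardTorusWith 2 L 1 U μ) *
          creation (orb (FermionTorus.ofTorusSite (Torus.proj L x)) σ) *
        exp (-(t • hubbardTorusWith 2 L 1 U μ)))
      (exp (s • hubbardTorusWith 2 L 1 U μ) *
          annihilation (orb (FermionTorus.ofTorusSite (Torus.proj L y)) σ') *
        exp (-(s • hubbardTorusWith 2 L 1 U μ)))

/-- At equal times `t = s = 0` the evolved two-point function is the fact's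
`hubbardThermalTwoPoint`. [folklore] -/
theorem hubbardThermalTwoPointEvolved_zero_zero (β U μ : ℝ) (L : ℕ) (x y : Site 2)
    (σ σ' : Fin 2) :
    hubbardThermalTwoPointEvolved β U μ L x σ 0 y σ' 0 =
      hubbardThermalTwoPoint β U μ L x y σ σ' := by
  unfold hubbardThermalTwoPointEvolved hubbardThermalTwoPoint
  split_ifs with hL
  · rfl
  · simp only [zero_smul, neg_zero, exp_zero, Matrix.one_mul, Matrix.mul_one]

/-- BGM's free propagator integrand at imaginary-time separation `τ` (tree convention):
`F^{τ}_{β,μ,z}(p) = e^{ip·z} e^{-τ(ε(p)-μ)} f_β(ε(p)-μ)`, `ε(p) = -2Σᵢ cos pᵢ`. BGM 2006, eq. (1.4).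
[cite: BenfattoGiulianiMastropietro2006, eq. (1.4)] -/
def freePropagatorIntegrandTime {d : ℕ} (β μ : ℝ) (τ : ℂ) (z : Site d) (p : Fin d → ℝ) : ℂ :=
  Complex.exp (Complex.I * ∑ i, ((p i * z i : ℝ) : ℂ)) *
    (Complex.exp (-τ * ((-2 * ∑ i, Real.cos (p i) - μ : ℝ) : ℂ)) *
      (fermiFunction β (-2 * ∑ i, Real.cos (p i) - μ) : ℂ))

/-- The time-dependent free propagator integrand is continuous in the momentum. [folklore] -/
theorem continuous_freePropagatorIntegrandTime {d : ℕ} (β μ : ℝ) (τ : ℂ) (z : Site d) :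
    Continuous (freePropagatorIntegrandTime β μ τ z) := by
  have hband : Continuous fun p : Fin d → ℝ => -2 * ∑ i, Real.cos (p i) - μ :=
    (continuous_const.mul (continuous_finsetSum _ fun i _ =>
      Real.continuous_cos.comp (continuous_apply i))).sub continuous_const
  unfold freePropagatorIntegrandTime fermiFunction
  refine Continuous.mul (Complex.continuous_exp.comp (continuous_const.mul
    (continuous_finsetSum _ fun i _ => Complex.continuous_ofReal.comp
      ((continuous_apply i).mul continuous_const)))) (Continuous.mul ?_ ?_)
  · exact Complex.continuous_exp.comp (continuous_const.mul (Complex.continuous_ofReal.comp hband))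
  · refine Complex.continuous_ofReal.comp (continuous_const.div (continuous_const.add
      (Real.continuous_exp.comp (continuous_const.mul hband))) fun p => ?_)
    positivity

/-- **The free imaginary-time two-point function as a momentum sum** (`U = 0`, `3 ≤ L`):
`⟨a⁺_{(x,σ)}(t) a⁻_{(y,σ')}(s)⟩_{β,L,U=0} = δ_{σσ'} L⁻² Σ_k F^{s-t}_{β,μ,y-x}(2πk/L)`.
BGM 2006, eqs. (1.2)–(1.4). [cite: BenfattoGiulianiMastropietro2006, eq. (1.4)] -/
theorem hubbardThermalTwoPointEvolved_zero_interaction_eq_sum {L : ℕ} (hL : 3 ≤ L) (β μ : ℝ)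
    (x y : Site 2) (σ σ' : Fin 2) (t s : ℂ) :
    hubbardThermalTwoPointEvolved β 0 μ L x σ t y σ' s =
      haveI : NeZero L := ⟨by omega⟩
      if σ = σ' then
        ((L : ℂ) ^ 2)⁻¹ * ∑ k : TorusSite 2 L,
          freePropagatorIntegrandTime β μ (s - t) (y - x) (latticeMomentum L k)
      else 0 := by
  haveI : NeZero L := ⟨by omega⟩
  unfold hubbardThermalTwoPointEvolved
  rw [dif_neg (NeZero.ne L)]
  have h := thermalCorr_torus_evolve_creation_annihilation (d := 2) hL β μ s t
    (FermionTorus.ofTorusSite (Torus.proj L x)) (FermionTorus.ofTorusSite (Torus.proj L y)) σ σ'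
  rw [show hubbardTorusWith 2 L 1 0 μ = hamiltonianWith (fermionTorusGraph 2 L) 1 0 μ from rfl, h]
  have hproj : Torus.proj L y - Torus.proj L x = Torus.proj L (y - x) := by
    funext i; simp [Torus.proj]
  simp only [FermionTorus.toTorusSite_ofTorusSite, hproj, torusChar_proj,
    freePropagatorIntegrandTime, torusBand, eq_comm]

/-- **The thermodynamic limit of the free imaginary-time two-point function**: for all
`β, μ, x, y, σ, σ'` and complex times `t, s`, as `L → ∞` through all naturals,
`⟨a⁺_{(x,σ)}(t) a⁻_{(y,σ')}(s)⟩_{β,L,U=0} → δ_{σσ'} (2π)⁻² ∫_{[-π,π]²} F^{s-t}_{β,μ,y-x}(q + π) dq`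
— BGM's free propagator `S₀` (1.4) "in the limit `L → ∞`" (eq. (2.4)), in finite temperature
and the tree's convention. [cite: BenfattoGiulianiMastropietro2006, eq. (2.4)] -/
theorem tendsto_hubbardThermalTwoPointEvolved_zero_interaction (β μ : ℝ) (x y : Site 2)
    (σ σ' : Fin 2) (t s : ℂ) :
    Tendsto (fun L : ℕ => hubbardThermalTwoPointEvolved β 0 μ L x σ t y σ' s) atTop
      (𝓝 (if σ = σ' then
        (((2 * Real.pi) ^ 2 : ℝ) : ℂ)⁻¹ *
          ∫ q in brillouin 2, freePropagatorIntegrandTime β μ (s - t) (y - x) (q + fun _ => Real.pi)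
        else 0)) := by
  have hev : (fun L : ℕ => hubbardThermalTwoPointEvolved β 0 μ L x σ t y σ' s) =ᶠ[atTop]
      fun L => if σ = σ' then (((2 * Real.pi) ^ 2 : ℝ) : ℂ)⁻¹ *
        cornerRiemannSum (fun q => freePropagatorIntegrandTime β μ (s - t) (y - x)
          (q + fun _ => Real.pi)) L
        else 0 := by
    refine (eventually_ge_atTop 3).mono fun L hL => ?_
    haveI : NeZero L := ⟨by omega⟩
    dsimp only
    rw [hubbardThermalTwoPointEvolved_zero_interaction_eq_sum hL, cornerRiemannSum_eq]
    split_ifs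
    · simp only [latticeMomentum_eq_cellCorner_add, Complex.real_smul, ← Finset.mul_sum,
        ← mul_assoc]
      congr 1
      have hL0 : (L : ℂ) ≠ 0 := by exact_mod_cast (NeZero.ne L)
      have hπ : (Real.pi : ℂ) ≠ 0 := by exact_mod_cast Real.pi_ne_zero
      simp only [gridStep]
      push_cast
      field_simp
    · rfl
  rw [tendsto_congr' hev]
  split_ifs
  · refine Tendsto.const_mul _ (tendsto_cornerRiemannSum ?_)
    exact ((continuous_freePropagatorIntegrandTime β μ (s - t) (y - x)).comp
      (continuous_id.add continuous_const)).continuousOn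
  · exact tendsto_const_nhds

end Evolved


end Literature.MathematicalPhysics.QuantumLattice

namespace Literature.MathematicalPhysics.QuantumLattice

open Filter Literature.Probability.LatticeModels
open scoped Topology

/-! ### The `L → ∞` limit of the free two-point function (BGM (1.4) → (2.4) at `U = 0`) -/

/-- For `L ≥ 3` the free two-point function is `(2π)⁻²` times the corner Riemann sum of the
shifted integrand `q ↦ F_{β,μ,y-x}(q + π)` over the grid cells of `[-π,π)²`. [folklore] -/
theorem hubbardThermalTwoPoint_zero_interaction_eq_cornerRiemannSum {L : ℕ} (hL : 3 ≤ L)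
    (β μ : ℝ) (x y : Site 2) (σ σ' : Fin 2) :
    hubbardThermalTwoPoint β 0 μ L x y σ σ' =
      if σ = σ' then
        (((2 * Real.pi) ^ 2 : ℝ) : ℂ)⁻¹ *
          cornerRiemannSum (fun q => freePropagatorIntegrand β μ (y - x) (q + fun _ => Real.pi)) L
      else 0 := by
  haveI : NeZero L := ⟨by omega⟩
  unfold hubbardThermalTwoPoint
  rw [dif_neg (NeZero.ne L), thermalCorr_hubbardTorusWith_zero_interaction_eq_sum_latticeMomentum hL,
    cornerRiemannSum_eq]
  split_ifs
  · simp only [latticeMomentum_eq_cellCorner_add, Complex.real_smul, ← Finset.mul_sum, ← mul_assoc]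
    congr 1
    have hL0 : (L : ℂ) ≠ 0 := by exact_mod_cast (NeZero.ne L)
    have hπ : (Real.pi : ℂ) ≠ 0 := by exact_mod_cast Real.pi_ne_zero
    simp only [gridStep]
    push_cast
    field_simp
  · rfl

/-- **The thermodynamic limit of the free two-point function** (the `U = 0` case of the
conclusion of `bgm_two_point_limit`, for all `β`, `μ`): as `L → ∞` through all naturals,
`⟨c†_{xσ} c_{yσ'}⟩_{β,L,U=0} → δ_{σσ'} (2π)⁻² ∫_{[-π,π]²} F_{β,μ,y-x}(q + π) dq`
`= δ_{σσ'} (2π)⁻² ∫_{[0,2π]²} e^{ip·(y-x)} (1 + e^{β(-2Σcos pᵢ - μ)})⁻¹ dp`, BGM's free propagator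
"in the limit `L → ∞`" at equal times (BGM 2006, eqs. (1.4), (2.4); Riemann sums of the
continuous integrand, `tendsto_cornerRiemannSum`). [cite: BenfattoGiulianiMastropietro2006, eq. (2.4)] -/
theorem tendsto_hubbardThermalTwoPoint_zero_interaction (β μ : ℝ) (x y : Site 2) (σ σ' : Fin 2) :
    Tendsto (fun L : ℕ => hubbardThermalTwoPoint β 0 μ L x y σ σ') atTop
      (𝓝 (if σ = σ' then
        (((2 * Real.pi) ^ 2 : ℝ) : ℂ)⁻¹ *
          ∫ q in brillouin 2, freePropagatorIntegrand β μ (y - x) (q + fun _ => Real.pi)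
        else 0)) := by
  have hev : (fun L : ℕ => hubbardThermalTwoPoint β 0 μ L x y σ σ') =ᶠ[atTop]
      fun L => if σ = σ' then (((2 * Real.pi) ^ 2 : ℝ) : ℂ)⁻¹ *
        cornerRiemannSum (fun q => freePropagatorIntegrand β μ (y - x) (q + fun _ => Real.pi)) L
        else 0 :=
    (eventually_ge_atTop 3).mono fun L hL =>
      hubbardThermalTwoPoint_zero_interaction_eq_cornerRiemannSum hL β μ x y σ σ'
  rw [tendsto_congr' hev]
  split_ifs
  · refine Tendsto.const_mul _ (tendsto_cornerRiemannSum ?_)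
    exact ((continuous_freePropagatorIntegrand β μ (y - x)).comp
      (continuous_id.add continuous_const)).continuousOn
  · exact tendsto_const_nhds

/-- Hence the `U = 0` analogue of the conclusion of `bgm_two_point_limit`: the free two-point
functions converge as `L → ∞`, for every `β`, `μ`, `x`, `y`, `σ`, `σ'`.
[cite: BenfattoGiulianiMastropietro2006, Thm. 1.1] -/
theorem exists_tendsto_hubbardThermalTwoPoint_zero_interaction (β μ : ℝ) (x y : Site 2)
    (σ σ' : Fin 2) :
    ∃ S : ℂ, Tendsto (fun L : ℕ => hubbardThermalTwoPoint β 0 μ L x y σ σ') atTop (𝓝 S) :=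
  ⟨_, tendsto_hubbardThermalTwoPoint_zero_interaction β μ x y σ σ'⟩

end Literature.MathematicalPhysics.QuantumLattice
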